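import Mathlib
import Literature.NumberTheory.LFunctions.Zhang2022.Section10Lemma102SSteps
import Literature.NumberTheory.LFunctions.Zhang2022.Section10CRanges1422
import Literature.NumberTheory.LFunctions.Zhang2022.Section10Range1113Top
import Literature.NumberTheory.LFunctions.Zhang2022.Section8XiZeroTailMean
import Literature.NumberTheory.LFunctions.Zhang2022.Section8AbelProfiles
import HarnessLib

/-!
# Zhang (2022) §10 pp. 60–61: tools for the three range evaluations of `S_j(𝐚₁₂,𝐚₁₄)`
# (DAG nodes Z22:§10.u055 (i), u056 (i), u057 (i) — `Typed.Sec10C.Low/Mid/Top1214Eval`)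

Topic `Literature/NumberTheory/LFunctions/Zhang2022` (Landau–Siegel audit tree; verdict-neutral).
Y. Zhang, *Discrete mean estimates and the Landau–Siegel zero*, arXiv:2211.02515v1 (2022)
[Zhang2022LandauSiegel], §10 pp. 60–61 ("By a result similar to Lemma 10.2 and the results in
Section 8, …" — the evaluation of `S_j(𝐚₁₂,𝐚₁₄)`, tex L3073–L3111) — **an unrefereed manuscript under
adjudication; this theorem-only TOOL file asserts nothing about its Theorems 1–2 or about
Landau–Siegel zeros.** ZHANG-L discharge lane (WP10, seat zl-w10-p1; leaf `Typed.Sec10C.Gather1214`,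
shared by the three range edges Low/Mid/Top1214Eval of seats p4/p1/p2). 0 definitions, 0 named facts.

* §1 `sum_vkGen_eq`, `mSum12_eq` — the `m`-sum of `S_j(𝐚₁₂,𝐚₁₄)` at `n = dr`,
  `Σ_m χ(m)(ῑ₃ϰ₃(nm) + ῑ₄ϰ₂(nm))m^{−(1−β_j)}`, IS `ῑ₃(log P₃)⁻¹·[Lemma 8.2's sum at x = P₃/n, μ = 6]
  + ῑ₄(log P₂)⁻¹·[the sum at x = P₂/n, μ = 7]` ((8.6): `ϰ_k(nm) = log(x/m)/log P_k·(x/m)^{β_μ}`);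
  `one_lt_P2`;
* §2 the two harmless replacements behind the PRINTED main terms: `norm_frakfW7_P2_div_sub_le`
  (`𝔣_{j7}(P₂/n)/log P₂` vs `𝔣_{j7}(P^{0.5}/n)/(0.5 log P)`: `≤ 5000𝓛^{1.1}α/𝓛⁹`, since
  `log P₂ = 0.5 log P − 10𝓛^{1.1}`; via the Lipschitz bound `norm_frakf_sub_frakf_le`) and
  `norm_fraky1_yShift_sub_le` (`𝔶₁ⱼ(y*)` vs `𝔶₁ⱼ(P^{0.004}y)`, `y* = yP^{0.004}/(Dt₀)`: `≤ 7100α𝓛`,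
  since `log(Dt₀) ≤ 520𝓛`);
* §3 the `n`-sum on the `T`-windows, where the shifted Lemma 10.2 has no evaluation (row G-d60-1):
  `norm_logMean_le_log_mul` (an untwisted log-mean `A(X) = Σ_{n≤X}χ(n)ξ₀ⱼ(n;d,r)n⁻¹log(X/n)` is at most
  `log X·Σ_{n<X}|ξ₀ⱼ|/n`, to be fed with the tree theorem `XiZeroMajorant.xiZeroTailMean`),
  `norm_logMean_main_le` (size of the log-mean main term), `norm_frakv2S_le_of_logMean_le`
  (`‖frakv2S‖ ≤ (500/log P)·4B` from a uniform bound `B` on the log-means, via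
  `Lemma102.frakv2S_eq_logMeans`);
* §4 `weight_sum_Icc_exp` — `Σ_{e^A≤n≤e^B}(n/φ(n))^k/n ≤ e^{2^{k+1}}(2 + B − A)` (any `1 ≤ A ≤ B`;
  the toolkit's `sum_ratio_pow_div_le`), for windows of logarithmic length `log(Dt₀)` and `𝓛^{1.1}`.

## References

* Y. Zhang, arXiv:2211.02515v1 (2022), §10 pp. 60–61, Lemma 10.2 p. 55, Remark p. 57, (10.9),
  Lemma 8.2 p. 46, (8.6). [cite: Zhang2022LandauSiegel, §10 pp. 60–61]
-/

noncomputable section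

open Complex Real Finset ComplexConjugate

namespace Literature.NumberTheory.LFunctions.Zhang2022.Typed.Sec10C

open Literature.NumberTheory.LFunctions.Zhang2022.Skeleton
open Literature.NumberTheory.LFunctions.Zhang2022.Typed.Sec10B (yShift frakv2S)
open Literature.NumberTheory.LFunctions.Zhang2022.Section8cProofs (betaJ_eq_real_mul_I large_D)

section W10Eval1214Tools

variable (c' : ℝ) {D : ℕ} (χ : DirichletCharacter ℂ D)

/-! ## §1. The `m`-sum of `S_j(𝐚₁₂,𝐚₁₄)` via Lemma 8.2's sums at `x = P₃/n` and `x = P₂/n` -/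

/-- A `ϰ`-weighted `m`-sum is Lemma 8.2's sum over `log Q`: for `v(k) = (1 − log k/log Q)(Q/k)^β`
(`k < Q`), `0` (`k ≥ Q`), `Q > 1`, `n ≥ 1` and `⌈Q/n⌉ ≤ N`:
`Σ_{1≤m<N} χ(m)v(nm)m^{β_j−1} = (log Q)⁻¹Σ_{m<Q/n} χ(m)m^{β_j−1}((Q/n)/m)^β log((Q/n)/m)`.
[cite: Zhang2022LandauSiegel, §8 (8.6), §10 p. 60] -/
theorem sum_vkGen_eq (j : ℕ) {Q : ℝ} (β : ℂ) (v : ℕ → ℂ)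
    (hv : ∀ k : ℕ, v k = if (k : ℝ) < Q then
      ((1 - Real.log k / Real.log Q : ℝ) : ℂ) * ((Q / k : ℝ) : ℂ) ^ β else 0)
    (hQ : 1 < Q) {n N : ℕ} (hn1 : 1 ≤ n) (hN : ⌈Q / n⌉₊ ≤ N) :
    ∑ m ∈ Finset.Ico 1 N, χ (m : ZMod D) * v (n * m) / (m : ℂ) ^ (1 - betaJ c' D j) =
      (1 / (Real.log Q : ℂ)) * ∑ m ∈ Finset.Ico 1 ⌈Q / n⌉₊,
        χ (m : ZMod D) / (m : ℂ) ^ (1 - betaJ c' D j) *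
          (((Q / n) / m : ℝ) : ℂ) ^ β * (Real.log ((Q / n) / m) : ℂ) := by
  classical
  set x : ℝ := Q / n with hx
  have hn0 : (0 : ℝ) < n := by exact_mod_cast hn1
  have hQ0 : 0 < Q := by linarith
  have hlogQ : 0 < Real.log Q := Real.log_pos hQ
  have hlogQC : (Real.log Q : ℂ) ≠ 0 := by exact_mod_cast hlogQ.ne'
  have hterm : ∀ m ∈ Finset.Ico 1 N,
      χ (m : ZMod D) * v (n * m) / (m : ℂ) ^ (1 - betaJ c' D j) =
        if m < ⌈x⌉₊ then
          (1 / (Real.log Q : ℂ)) * (χ (m : ZMod D) / (m : ℂ) ^ (1 - betaJ c' D j) *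
            ((x / m : ℝ) : ℂ) ^ β * (Real.log (x / m) : ℂ)) else 0 := by
    intro m hm
    have hm1 : 1 ≤ m := (Finset.mem_Ico.mp hm).1
    have hm0 : (0 : ℝ) < m := by exact_mod_cast hm1
    have hnm : ((n * m : ℕ) : ℝ) = (n : ℝ) * m := by push_cast; ring
    split_ifs with hmx
    · have hmx' : (m : ℝ) < x := Nat.lt_ceil.mp hmx
      have hnmQ : ((n * m : ℕ) : ℝ) < Q := by
        rw [hnm]; rw [hx, lt_div_iff₀ hn0, mul_comm] at hmx'; exact hmx'
      have hquot : Q / ((n * m : ℕ) : ℝ) = x / m := by rw [hnm, hx, div_div]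
      have hcoef : (1 - Real.log ((n * m : ℕ) : ℝ) / Real.log Q) = Real.log (x / m) / Real.log Q := by
        rw [← hquot, Real.log_div hQ0.ne' (by rw [hnm]; positivity)]
        field_simp
      rw [hv (n * m), if_pos hnmQ, hquot, hcoef]
      push_cast
      field_simp
    · have hmx' : x ≤ m := le_trans (Nat.le_ceil x) (by exact_mod_cast Nat.le_of_not_lt hmx)
      have hnmQ : ¬ ((n * m : ℕ) : ℝ) < Q := by
        rw [hnm, not_lt]
        rw [hx, div_le_iff₀ hn0] at hmx'
        linarith [mul_comm (m : ℝ) n]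
      rw [hv (n * m), if_neg hnmQ]
      simp
  rw [Finset.sum_congr rfl hterm, ← Finset.sum_filter, Finset.mul_sum]
  congr 1
  ext m
  simp only [Finset.mem_filter, Finset.mem_Ico]
  constructor
  · rintro ⟨⟨h1, -⟩, h3⟩; exact ⟨h1, h3⟩
  · rintro ⟨h1, h3⟩; exact ⟨⟨h1, lt_of_lt_of_le h3 hN⟩, h3⟩

/-- `P₂ > 1` once `𝓛 ≥ 2` (`log P₂ = 0.5𝓛⁹ − 10𝓛^{1.1} > 0`). [cite: Zhang2022LandauSiegel, §2 (2.21)] -/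
theorem one_lt_P2 (hD : 2 ≤ Real.log D) : 1 < Skeleton.P2 D := by
  have hℓ : 2 ≤ ell D := by rw [ell]; exact hD
  have hℓ1 : (1 : ℝ) ≤ ell D := by linarith
  have h11 : ell D ^ (1.1 : ℝ) ≤ ell D ^ 2 := by
    calc ell D ^ (1.1 : ℝ) ≤ ell D ^ (2 : ℝ) := Real.rpow_le_rpow_of_exponent_le hℓ1 (by norm_num)
      _ = ell D ^ 2 := by norm_cast
  have h9 : ell D ^ 9 = ell D ^ 2 * ell D ^ 7 := by ring
  have h7 : (128 : ℝ) ≤ ell D ^ 7 := by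
    calc (128 : ℝ) = 2 ^ 7 := by norm_num
      _ ≤ ell D ^ 7 := pow_le_pow_left₀ (by norm_num) hℓ 7
  rw [Skeleton.P2, bigT, bigP, ← Real.exp_mul, ← Real.exp_nat_mul, ← Real.exp_sub,
    Real.one_lt_exp_iff]
  have h2pos : 0 < ell D ^ 2 := by positivity
  push_cast
  nlinarith

/-- For `𝓛 ≥ 2` and `d, r ≥ 1`, **the `m`-sum of `S_j(𝐚₁₂,𝐚₁₄)` at `n = dr`** equals
`ῑ₃(log P₃)⁻¹·[Lemma 8.2's sum at x = P₃/n, μ = 6] + ῑ₄(log P₂)⁻¹·[the sum at x = P₂/n, μ = 7]`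
(`ϰ₃(nm) = log(x/m)/log P₃·(x/m)^{β₆}` for `m < x = P₃/n`, `0` otherwise; likewise `ϰ₂`).
[cite: Zhang2022LandauSiegel, §10 p. 60, §8 (8.6)] -/
theorem mSum12_eq (hD : 2 ≤ Real.log D) (j : ℕ) {d r : ℕ} (hd : 1 ≤ d) (hr : 1 ≤ r) :
    Sec10C.mSum12 c' χ j d r =
      conj iota3 * ((1 / (Real.log (Skeleton.P3 D) : ℂ)) *
        ∑ m ∈ Finset.Ico 1 ⌈Skeleton.P3 D / ((d * r : ℕ) : ℝ)⌉₊,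
          χ (m : ZMod D) / (m : ℂ) ^ (1 - betaJ c' D j) *
            (((Skeleton.P3 D / ((d * r : ℕ) : ℝ)) / m : ℝ) : ℂ) ^ beta6 D *
              (Real.log ((Skeleton.P3 D / ((d * r : ℕ) : ℝ)) / m) : ℂ)) +
      conj iota4 * ((1 / (Real.log (Skeleton.P2 D) : ℂ)) *
        ∑ m ∈ Finset.Ico 1 ⌈Skeleton.P2 D / ((d * r : ℕ) : ℝ)⌉₊,
          χ (m : ZMod D) / (m : ℂ) ^ (1 - betaJ c' D j) *
            (((Skeleton.P2 D / ((d * r : ℕ) : ℝ)) / m : ℝ) : ℂ) ^ beta7 D *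
              (Real.log ((Skeleton.P2 D / ((d * r : ℕ) : ℝ)) / m) : ℂ)) := by
  classical
  have hn1 : 1 ≤ d * r := Nat.one_le_iff_ne_zero.mpr (Nat.mul_ne_zero (by omega) (by omega))
  have hn0 : (0 : ℝ) < ((d * r : ℕ) : ℝ) := by exact_mod_cast hn1
  have hP : 1 < bigP D := by
    rw [bigP]; exact Real.one_lt_exp_iff.mpr (by rw [ell]; positivity)
  have hP3 : 1 < Skeleton.P3 D := Real.one_lt_rpow hP (by norm_num)
  have hP2 : 1 < Skeleton.P2 D := one_lt_P2 hD
  -- the two index ranges sit inside `Ico 1 Nsupp`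
  have hceil : ∀ {Q : ℝ}, 0 ≤ Q → Q ≤ Skeleton.P1 D → ⌈Q / ((d * r : ℕ) : ℝ)⌉₊ ≤ Nsupp D := by
    intro Q hQ0 hQ
    refine le_trans (Nat.ceil_mono ?_) (ceil_P1_le_Nsupp D hD)
    exact (div_le_self hQ0 (by exact_mod_cast hn1)).trans hQ
  have h3 := sum_vkGen_eq c' χ j (beta6 D) (vk3 D) (fun k => by rw [vk3]) hP3 hn1
    (hceil (by linarith) (P3_le_P1 D))
  have h2 := sum_vkGen_eq c' χ j (beta7 D) (vk2 D) (fun k => by rw [vk2]) hP2 hn1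
    (hceil (by linarith) (P2_le_P1 D))
  unfold Sec10C.mSum12
  have hsplit : ∀ m ∈ Finset.Ico 1 (Nsupp D),
      χ (m : ZMod D) * (conj iota3 * vk3 D (d * r * m) + conj iota4 * vk2 D (d * r * m)) /
          (m : ℂ) ^ (1 - betaJ c' D j) =
        conj iota3 * (χ (m : ZMod D) * vk3 D (d * r * m) / (m : ℂ) ^ (1 - betaJ c' D j)) +
          conj iota4 * (χ (m : ZMod D) * vk2 D (d * r * m) / (m : ℂ) ^ (1 - betaJ c' D j)) := by
    intro m _; ring
  rw [Finset.sum_congr rfl hsplit, Finset.sum_add_distrib, ← Finset.mul_sum, ← Finset.mul_sum,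
    h3, h2]

/-! ## §2. The shift `P₂ ↦ P^{0.5}` in the `𝔣_{j7}`-term and `y* ↦ P^{0.004}n` in `𝔶₁ⱼ` -/

/-- `‖e^{βL} − e^{βL′}‖ ≤ ‖β‖|L − L′|` for `β` purely imaginary and real `L, L′`. [folklore] -/
private theorem norm_cexp_sub_cexp_le {β : ℂ} (hβ : β.re = 0) (L L' : ℝ) :
    ‖cexp (β * (L : ℂ)) - cexp (β * (L' : ℂ))‖ ≤ ‖β‖ * |L - L'| := by
  have he : ‖cexp (β * (L' : ℂ))‖ = 1 := by
    rw [Complex.norm_exp]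
    have : (β * (L' : ℂ)).re = 0 := by simp [Complex.mul_re, hβ]
    rw [this, Real.exp_zero]
  have harg : β * (L : ℂ) = β * (L' : ℂ) + I * ((β.im * (L - L') : ℝ) : ℂ) := by
    apply Complex.ext
    · simp [hβ]
    · simp [hβ]; ring
  have hfac : cexp (β * (L : ℂ)) - cexp (β * (L' : ℂ)) =
      cexp (β * (L' : ℂ)) * (cexp (I * ((β.im * (L - L') : ℝ) : ℂ)) - 1) := by
    rw [mul_sub, mul_one, ← Complex.exp_add, harg]
  rw [hfac, norm_mul, he, one_mul]
  refine Real.norm_exp_I_mul_ofReal_sub_one_le.trans ?_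
  rw [Real.norm_eq_abs, abs_mul]
  gcongr
  exact Complex.abs_im_le_norm β

/-- Lipschitz bound for `𝔣_{jμ}` in the logarithm: for `β_μ` purely imaginary, `‖β_μ‖ ≤ 3a`,
`‖β_j‖ ≤ 4a`, `a|L′| ≤ 4`: `‖𝔣(β_j,β_μ;L) − 𝔣(β_j,β_μ;L′)‖ ≤ 94a|L − L′|`
(`𝔣(L) = (1 + (β_μ−β_j)L)e^{β_μL}`). [cite: Zhang2022LandauSiegel, §8 Lemma 8.2] -/
theorem norm_frakf_sub_frakf_le {βj βμ : ℂ} {a L L' : ℝ} (hμre : βμ.re = 0)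
    (hμ : ‖βμ‖ ≤ 3 * a) (hj : ‖βj‖ ≤ 4 * a) (hL' : a * |L'| ≤ 4) :
    ‖frakf βj βμ L - frakf βj βμ L'‖ ≤ 94 * a * |L - L'| := by
  have hδ : ‖βμ - βj‖ ≤ 7 * a := (norm_sub_le _ _).trans (by linarith)
  have he : ‖cexp (βμ * (L : ℂ))‖ = 1 := by
    rw [Complex.norm_exp]
    have : (βμ * (L : ℂ)).re = 0 := by simp [Complex.mul_re, hμre]
    rw [this, Real.exp_zero]
  have hexp_sub := norm_cexp_sub_cexp_le hμre L L'
  have e : frakf βj βμ L - frakf βj βμ L' =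
      (βμ - βj) * ((L - L' : ℝ) : ℂ) * cexp (βμ * (L : ℂ)) +
        (1 + (βμ - βj) * (L' : ℂ)) * (cexp (βμ * (L : ℂ)) - cexp (βμ * (L' : ℂ))) := by
    unfold frakf; push_cast; ring
  rw [e]
  have hL'n : ‖(L' : ℂ)‖ = |L'| := by rw [Complex.norm_real, Real.norm_eq_abs]
  have h1 : ‖1 + (βμ - βj) * (L' : ℂ)‖ ≤ 29 := by
    calc ‖1 + (βμ - βj) * (L' : ℂ)‖ ≤ ‖(1 : ℂ)‖ + ‖(βμ - βj) * (L' : ℂ)‖ := norm_add_le _ _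
      _ = 1 + ‖βμ - βj‖ * |L'| := by rw [norm_one, norm_mul, hL'n]
      _ ≤ 1 + 7 * a * |L'| := by gcongr
      _ ≤ 29 := by nlinarith [abs_nonneg L']
  have hdL : 0 ≤ |L - L'| := abs_nonneg _
  calc ‖(βμ - βj) * ((L - L' : ℝ) : ℂ) * cexp (βμ * (L : ℂ)) +
        (1 + (βμ - βj) * (L' : ℂ)) * (cexp (βμ * (L : ℂ)) - cexp (βμ * (L' : ℂ)))‖
      ≤ ‖(βμ - βj) * ((L - L' : ℝ) : ℂ) * cexp (βμ * (L : ℂ))‖ +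
        ‖(1 + (βμ - βj) * (L' : ℂ)) * (cexp (βμ * (L : ℂ)) - cexp (βμ * (L' : ℂ)))‖ :=
        norm_add_le _ _
    _ = ‖βμ - βj‖ * |L - L'| +
        ‖1 + (βμ - βj) * (L' : ℂ)‖ * ‖cexp (βμ * (L : ℂ)) - cexp (βμ * (L' : ℂ))‖ := by
        rw [norm_mul, norm_mul, he, mul_one, Complex.norm_real, Real.norm_eq_abs, norm_mul]
    _ ≤ 7 * a * |L - L'| + 29 * (3 * a * |L - L'|) := by
        gcongr
        exact hexp_sub.trans (by gcongr)
    _ = 94 * a * |L - L'| := by ring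

/-- `β₇` is purely imaginary with `‖β₇‖ = 5α/2 ≤ 3α` (`α ≥ 0`). [cite: Zhang2022LandauSiegel, §2 (2.22)] -/
theorem beta7_facts {D : ℕ} (hα : 0 ≤ alpha D) : (beta7 D).re = 0 ∧ ‖beta7 D‖ ≤ 3 * alpha D := by
  refine ⟨by simp [beta7], ?_⟩
  rw [beta7, norm_div, norm_mul, norm_mul, Complex.norm_I, Complex.norm_real, Real.norm_of_nonneg hα]
  norm_num
  linarith

/-- `‖f₁/Λ₂ − f₂/Λ₅‖ ≤ ‖f₁ − f₂‖/Λ₂ + ‖f₂‖·|Λ₅ − Λ₂|/(Λ₂Λ₅)` (`Λ₂, Λ₅ > 0`). [folklore] -/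
private theorem norm_div_sub_div_le (f₁ f₂ : ℂ) {Λ₂ Λ₅ : ℝ} (h2 : 0 < Λ₂) (h5 : 0 < Λ₅) :
    ‖f₁ / (Λ₂ : ℂ) - f₂ / (Λ₅ : ℂ)‖ ≤ ‖f₁ - f₂‖ / Λ₂ + ‖f₂‖ * (|Λ₅ - Λ₂| / (Λ₂ * Λ₅)) := by
  have hΛ₂C : (Λ₂ : ℂ) ≠ 0 := by exact_mod_cast h2.ne'
  have hΛ₅C : (Λ₅ : ℂ) ≠ 0 := by exact_mod_cast h5.ne'
  have e : f₁ / (Λ₂ : ℂ) - f₂ / (Λ₅ : ℂ) =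
      (f₁ - f₂) / (Λ₂ : ℂ) + f₂ * (((Λ₅ - Λ₂ : ℝ) : ℂ) / ((Λ₂ : ℂ) * (Λ₅ : ℂ))) := by
    push_cast
    field_simp
    ring
  rw [e]
  have n2 : ‖(Λ₂ : ℂ)‖ = Λ₂ := by rw [Complex.norm_real, Real.norm_of_nonneg h2.le]
  have n5 : ‖(Λ₅ : ℂ)‖ = Λ₅ := by rw [Complex.norm_real, Real.norm_of_nonneg h5.le]
  have n52 : ‖((Λ₅ - Λ₂ : ℝ) : ℂ)‖ = |Λ₅ - Λ₂| := by rw [Complex.norm_real, Real.norm_eq_abs]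
  refine (norm_add_le _ _).trans (le_of_eq ?_)
  simp only [norm_div, norm_mul, n2, n5, n52]

/-- The scalar bookkeeping of `norm_frakfW7_P2_div_sub_le`: with `Λ₂ = 0.5ℓ⁹ − 10τ ≥ 0.4ℓ⁹`,
`E ≤ 940aτ`, `F ≤ 29`, `3 ≤ aℓ⁹`: `E/Λ₂ + F·10τ/(Λ₂·0.5ℓ⁹) ≤ 5000τa/ℓ⁹`. [folklore] -/
private theorem P2_shift_arith {a τ ℓ E F Λ₂ : ℝ} (hℓ : 0 < ℓ) (hτ : 0 ≤ τ) (ha : 0 ≤ a)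
    (haℓ : 3 ≤ a * ℓ ^ 9) (hΛ₂ : 0.4 * ℓ ^ 9 ≤ Λ₂) (hE : E ≤ 94 * a * (10 * τ)) (hF : F ≤ 29) :
    E / Λ₂ + F * (10 * τ / (Λ₂ * (0.5 * ℓ ^ 9))) ≤ 5000 * τ * a / ℓ ^ 9 := by
  have hℓ9 : 0 < ℓ ^ 9 := by positivity
  have hΛ₂0 : 0 < Λ₂ := by nlinarith
  have h1 : E / Λ₂ ≤ 94 * a * (10 * τ) / (0.4 * ℓ ^ 9) :=
    div_le_div₀ (by positivity) hE (by positivity) hΛ₂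
  have h2 : F * (10 * τ / (Λ₂ * (0.5 * ℓ ^ 9))) ≤ 29 * (10 * τ / (0.4 * ℓ ^ 9 * (0.5 * ℓ ^ 9))) := by
    gcongr
  have e1 : 94 * a * (10 * τ) / (0.4 * ℓ ^ 9) = 2350 * (τ * a / ℓ ^ 9) := by
    field_simp; ring
  have e2 : 29 * (10 * τ / (0.4 * ℓ ^ 9 * (0.5 * ℓ ^ 9))) = 1450 * (τ / ℓ ^ 9) / ℓ ^ 9 := by
    field_simp; ring
  have h3 : 1450 * (τ / ℓ ^ 9) / ℓ ^ 9 ≤ 500 * (τ * a / ℓ ^ 9) := by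
    rw [div_le_iff₀ hℓ9]
    have : 500 * (τ * a / ℓ ^ 9) * ℓ ^ 9 = 500 * τ * a := by field_simp
    rw [this]
    have h4 : τ / ℓ ^ 9 * 3 ≤ τ * a := by
      rw [div_mul_eq_mul_div, div_le_iff₀ hℓ9]; nlinarith
    nlinarith
  calc E / Λ₂ + F * (10 * τ / (Λ₂ * (0.5 * ℓ ^ 9)))
      ≤ 2350 * (τ * a / ℓ ^ 9) + 1450 * (τ / ℓ ^ 9) / ℓ ^ 9 := by rw [← e1, ← e2]; exact add_le_add h1 h2
    _ ≤ 2350 * (τ * a / ℓ ^ 9) + 500 * (τ * a / ℓ ^ 9) := by linarith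
    _ ≤ 5000 * τ * a / ℓ ^ 9 := by
        have : 0 ≤ τ * a / ℓ ^ 9 := by positivity
        rw [show 5000 * τ * a / ℓ ^ 9 = 5000 * (τ * a / ℓ ^ 9) by ring]
        linarith

/-- **The `P₂ ↦ P^{0.5}` replacement in the `𝔣_{j7}`-term**: for `𝓛 ≥ 5`, `5|c′|α𝓛 ≤ 1` and
`P^{0.496} ≤ n < P^{0.5}`:
`‖𝔣_{j7}(P₂/n)/log P₂ − 𝔣_{j7}(P^{0.5}/n)/(0.5 log P)‖ ≤ 5000·𝓛^{1.1}·α/𝓛⁹`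
(`log P₂ = 0.5𝓛⁹ − 10𝓛^{1.1}`, `‖𝔣‖ ≤ 29`, `‖∂_L𝔣‖ ≤ 94α`). [cite: Zhang2022LandauSiegel, §10 p. 61] -/
theorem norm_frakfW7_P2_div_sub_le (hL5 : 5 ≤ ell D) (hc : 5 * |c'| * alpha D * ell D ≤ 1) (j : ℕ)
    {n : ℕ} (hn1 : 1 ≤ n) (hlo : bigP D ^ (0.496 : ℝ) ≤ (n : ℝ)) (hhi : (n : ℝ) < bigP D ^ (0.5 : ℝ)) :
    ‖frakfW c' D j 7 (Skeleton.P2 D / n) / (Real.log (Skeleton.P2 D) : ℂ) -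
        frakfW c' D j 7 (bigP D ^ (0.5 : ℝ) / n) / ((0.5 * Real.log (bigP D) : ℝ) : ℂ)‖ ≤
      5000 * ell D ^ (1.1 : ℝ) * alpha D / ell D ^ 9 := by
  have hℓ0 : 0 < ell D := by linarith
  have hℓ1 : 1 ≤ ell D := by linarith
  have hn0 : (0 : ℝ) < n := by exact_mod_cast hn1
  have hP0 : 0 < bigP D := Real.exp_pos _
  have hT0 : 0 < bigT D := Real.exp_pos _
  have hα : alpha D = π / ell D ^ 9 := by rw [alpha, bigP, Real.log_exp]
  have hα0 : 0 < alpha D := by rw [hα]; positivity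
  have hlogP : Real.log (bigP D) = ell D ^ 9 := by rw [bigP, Real.log_exp]
  have hlogT : Real.log (bigT D) = ell D ^ (1.1 : ℝ) := by rw [bigT, Real.log_exp]
  set τ : ℝ := ell D ^ (1.1 : ℝ) with hτ
  have hτ0 : 0 < τ := Real.rpow_pos_of_pos hℓ0 _
  have hτ2 : τ ≤ ell D ^ 2 := (bigT_lt_rpow hL5).1
  have h7 : (78125 : ℝ) ≤ ell D ^ 7 := by
    calc (78125 : ℝ) = 5 ^ 7 := by norm_num
      _ ≤ ell D ^ 7 := pow_le_pow_left₀ (by norm_num) hL5 7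
  have h9 : ell D ^ 9 = ell D ^ 2 * ell D ^ 7 := by ring
  have hτsmall : 100 * τ ≤ 0.1 * ell D ^ 9 := by rw [h9]; nlinarith [pow_nonneg hℓ0.le 2]
  have hP2pos : 0 < Skeleton.P2 D := div_pos (Real.rpow_pos_of_pos hP0 _) (pow_pos hT0 10)
  -- the two logarithms
  have hlogP2 : Real.log (Skeleton.P2 D) = 0.5 * ell D ^ 9 - 10 * τ := by
    rw [Skeleton.P2, Real.log_div (Real.rpow_pos_of_pos hP0 _).ne' (pow_pos hT0 10).ne',
      Real.log_rpow hP0, Real.log_pow, hlogT, hlogP]; push_cast; ring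
  have hΛ2pos : 0 < Real.log (Skeleton.P2 D) := by rw [hlogP2]; nlinarith [pow_nonneg hℓ0.le 9]
  have hΛ5 : (0.5 : ℝ) * Real.log (bigP D) = 0.5 * ell D ^ 9 := by rw [hlogP]
  have hΛ5pos : 0 < (0.5 : ℝ) * Real.log (bigP D) := by rw [hΛ5]; positivity
  -- `𝔣_{j7}` at the two points
  have hμ : betaMu D 7 = beta7 D := by norm_num [betaMu]
  have hL12 : Real.log (Skeleton.P2 D / n) - Real.log (bigP D ^ (0.5 : ℝ) / n) = -(10 * τ) := by
    rw [Real.log_div hP2pos.ne' hn0.ne', Real.log_div (Real.rpow_pos_of_pos hP0 _).ne' hn0.ne',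
      hlogP2, Real.log_rpow hP0, hlogP]; ring
  -- sizes: `|L₂| ≤ 0.004ℓ⁹`, so `α|L₂| ≤ 4`
  have hlogn_lo : 0.496 * ell D ^ 9 ≤ Real.log n := by
    rw [← Real.log_exp (0.496 * ell D ^ 9), ← bigP_rpow]
    exact Real.log_le_log (by rw [bigP_rpow]; exact Real.exp_pos _) hlo
  have hlogn_hi : Real.log n < 0.5 * ell D ^ 9 := by
    rw [← Real.log_exp (0.5 * ell D ^ 9), ← bigP_rpow]; exact Real.log_lt_log hn0 hhi
  have hL₂abs : |Real.log (bigP D ^ (0.5 : ℝ) / n)| ≤ 0.004 * ell D ^ 9 := by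
    rw [Real.log_div (Real.rpow_pos_of_pos hP0 _).ne' hn0.ne', Real.log_rpow hP0, hlogP, abs_le]
    constructor <;> linarith
  have hαL₂ : alpha D * |Real.log (bigP D ^ (0.5 : ℝ) / n)| ≤ 4 := by
    calc alpha D * |Real.log (bigP D ^ (0.5 : ℝ) / n)| ≤ (π / ell D ^ 9) * (0.004 * ell D ^ 9) := by
          rw [hα]; gcongr
      _ = 0.004 * π := by field_simp
      _ ≤ 4 := by nlinarith [Real.pi_lt_four]
  obtain ⟨h7re, h7n⟩ := beta7_facts (D := D) hα0.le
  have hβj := Section8AbelProfiles.norm_betaJ_le c' hα0.le hℓ0.le hc j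
  have hF2 : ‖frakfW c' D j 7 (bigP D ^ (0.5 : ℝ) / n)‖ ≤ 29 := by
    rw [frakfW, hμ]; exact (Section8AbelProfiles.norm_frakf_le h7re h7n hβj hαL₂).1
  have hdiff : ‖frakfW c' D j 7 (Skeleton.P2 D / n) - frakfW c' D j 7 (bigP D ^ (0.5 : ℝ) / n)‖ ≤
      94 * alpha D * (10 * τ) := by
    rw [frakfW, frakfW, hμ]
    have h := norm_frakf_sub_frakf_le (L := Real.log (Skeleton.P2 D / n)) h7re h7n hβj hαL₂
    rw [hL12, abs_neg, abs_of_pos (by positivity)] at h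
    exact h
  refine (norm_div_sub_div_le _ _ hΛ2pos hΛ5pos).trans ?_
  rw [hlogP2, hΛ5]
  have hgap : |0.5 * ell D ^ 9 - (0.5 * ell D ^ 9 - 10 * τ)| = 10 * τ := by
    rw [show 0.5 * ell D ^ 9 - (0.5 * ell D ^ 9 - 10 * τ) = 10 * τ by ring, abs_of_pos (by positivity)]
  rw [hgap]
  have hΛ2ge : 0.4 * ell D ^ 9 ≤ 0.5 * ell D ^ 9 - 10 * τ := by nlinarith [pow_nonneg hℓ0.le 9]
  have haℓ : 3 ≤ alpha D * ell D ^ 9 := by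
    rw [hα, div_mul_cancel₀ _ (by positivity)]; linarith [Real.pi_gt_three]
  exact P2_shift_arith hℓ0 hτ0.le hα0.le haℓ hΛ2ge hdiff hF2

/-- `𝔶₁ⱼ` written out. [cite: Zhang2022LandauSiegel, §10 (10.9)] -/
theorem fraky1_apply (j : ℕ) (y : ℝ) :
    fraky1 c' D j y = (betaJ c' D (j + 1) + betaJ c' D (j + 2)) *
        (Real.log (y / bigP D ^ (0.5 : ℝ)) : ℂ) +
      betaJ c' D (j + 1) * betaJ c' D (j + 2) / 2 *
        ((Real.log (bigP D ^ (0.504 : ℝ) / y) : ℂ) ^ 2 -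
          2 * (Real.log (bigP D ^ (0.502 : ℝ) / y) : ℂ) ^ 2) := rfl

/-- The algebra of the `𝔶₁ⱼ`-difference under a common shift `Δ` of the three logarithms. [folklore] -/
private theorem fraky1_shift_identity (βa βb : ℂ) (l0 m1 m2 Δ : ℝ) :
    (βa + βb) * (((l0 - Δ : ℝ)) : ℂ) +
        βa * βb / 2 * ((((m1 + Δ : ℝ)) : ℂ) ^ 2 - 2 * (((m2 + Δ : ℝ)) : ℂ) ^ 2) -
      ((βa + βb) * (l0 : ℂ) + βa * βb / 2 * ((m1 : ℂ) ^ 2 - 2 * (m2 : ℂ) ^ 2)) =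
      (βa + βb) * ((-Δ : ℝ) : ℂ) +
        βa * βb / 2 * ((((2 * m1 + Δ) * Δ : ℝ) : ℂ) - 2 * ((((2 * m2 + Δ) * Δ : ℝ)) : ℂ)) := by
  push_cast; ring

/-- The scalar bookkeeping of `norm_fraky1_yShift_sub_le`. [folklore] -/
private theorem yShift_arith {a ℓ : ℝ} (ha : 0 ≤ a) (hℓ : 0 ≤ ℓ) (haℓ : a * ℓ ^ 9 ≤ 3.15) :
    (6 * a + 6 * a) * (520 * ℓ) + 6 * a * (6 * a) / 2 * (5 * ℓ ^ 10 + 2 * (5 * ℓ ^ 10)) ≤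
      7100 * a * ℓ := by
  have e : (6 * a + 6 * a) * (520 * ℓ) + 6 * a * (6 * a) / 2 * (5 * ℓ ^ 10 + 2 * (5 * ℓ ^ 10)) =
      a * ℓ * (6240 + 270 * (a * ℓ ^ 9)) := by ring
  rw [e]
  have hal : 0 ≤ a * ℓ := mul_nonneg ha hℓ
  have : 6240 + 270 * (a * ℓ ^ 9) ≤ 7100 := by linarith
  calc a * ℓ * (6240 + 270 * (a * ℓ ^ 9)) ≤ a * ℓ * 7100 := mul_le_mul_of_nonneg_left this hal
    _ = 7100 * a * ℓ := by ring

/-- **The `y* ↦ P^{0.004}y` replacement in `𝔶₁ⱼ`**: for `𝓛 ≥ 5`, `|c′|α𝓛 ≤ 1` and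
`P^{0.496} ≤ y ≤ P^{0.5}`: `‖𝔶₁ⱼ(y*) − 𝔶₁ⱼ(P^{0.004}y)‖ ≤ 7100·α·𝓛` where `y* = yP^{0.004}/(Dt₀)`
(the three logarithms shift by `−log(Dt₀)`, `+log(Dt₀)`, `+log(Dt₀)` with `log(Dt₀) ≤ 520𝓛`;
`‖β‖ ≤ 6α`). [cite: Zhang2022LandauSiegel, §10 (10.9), Remark p. 57] -/
theorem norm_fraky1_yShift_sub_le (hL5 : 5 ≤ ell D) (hc : |c'| * alpha D * ell D ≤ 1) (j : ℕ)
    {y : ℝ} (hlo : bigP D ^ (0.496 : ℝ) ≤ y) (hhi : y ≤ bigP D ^ (0.5 : ℝ)) :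
    ‖fraky1 c' D j (yShift D y) - fraky1 c' D j (bigP D ^ (0.004 : ℝ) * y)‖ ≤
      7100 * alpha D * ell D := by
  have hℓ0 : 0 < ell D := by linarith
  have hℓ1 : 1 ≤ ell D := by linarith
  have hP0 : 0 < bigP D := Real.exp_pos _
  have hy0 : 0 < y := lt_of_lt_of_le (Real.rpow_pos_of_pos hP0 _) hlo
  have hα : alpha D = π / ell D ^ 9 := by rw [alpha, bigP, Real.log_exp]
  have hα0 : 0 < alpha D := by rw [hα]; positivity
  have hαℓ9 : alpha D * ell D ^ 9 = π := by rw [hα]; field_simp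
  have hlogP : Real.log (bigP D) = ell D ^ 9 := by rw [bigP, Real.log_exp]
  have hD2 : 2 ≤ D := by
    by_contra h
    have h2 : D < 2 := not_le.mp h
    interval_cases D <;> simp [ell] at hL5 <;> linarith
  have hD0 : (0 : ℝ) < D := by exact_mod_cast (by omega : 0 < D)
  -- `Dt₀`: `1 ≤ Dt₀`, `Δ = log(Dt₀) ∈ [0, 520ℓ]`
  have hDt1 : 1 ≤ (D : ℝ) * t0 D := Lemma102.one_le_Dt0 hℓ1
  have hDt0 : 0 < (D : ℝ) * t0 D := by linarith
  set Δ : ℝ := Real.log ((D : ℝ) * t0 D) with hΔ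
  have hΔ0 : 0 ≤ Δ := Real.log_nonneg hDt1
  have hΔle : Δ ≤ 520 * ell D := by
    rw [hΔ, Real.log_mul hD0.ne' (by rw [t0]; positivity), t0, Real.log_pow]
    have : Real.log (ell D) ≤ ell D - 1 := Real.log_le_sub_one_of_pos hℓ0
    have hℓdef : Real.log (D : ℝ) = ell D := rfl
    rw [hℓdef]; push_cast; nlinarith
  -- the two arguments and their logs
  set y₂ : ℝ := bigP D ^ (0.004 : ℝ) * y with hy₂
  have hy₂0 : 0 < y₂ := by positivity
  have hy₁eq : yShift D y = y₂ / ((D : ℝ) * t0 D) := by rw [yShift, hy₂]; ring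
  have hy₁0 : 0 < yShift D y := by rw [hy₁eq]; positivity
  have hlogy₁ : Real.log (yShift D y) = Real.log y₂ - Δ := by
    rw [hy₁eq, Real.log_div hy₂0.ne' hDt0.ne']
  have hlogy_lo : 0.496 * ell D ^ 9 ≤ Real.log y := by
    rw [← Real.log_exp (0.496 * ell D ^ 9), ← bigP_rpow]
    exact Real.log_le_log (by rw [bigP_rpow]; exact Real.exp_pos _) hlo
  have hlogy_hi : Real.log y ≤ 0.5 * ell D ^ 9 := by
    rw [← Real.log_exp (0.5 * ell D ^ 9), ← bigP_rpow]; exact Real.log_le_log hy0 hhi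
  have hlogy₂ : Real.log y₂ = 0.004 * ell D ^ 9 + Real.log y := by
    rw [hy₂, Real.log_mul (Real.rpow_pos_of_pos hP0 _).ne' hy0.ne', Real.log_rpow hP0, hlogP]
  set l0 : ℝ := Real.log (y₂ / bigP D ^ (0.5 : ℝ)) with hl0
  set m1 : ℝ := Real.log (bigP D ^ (0.504 : ℝ) / y₂) with hm1
  set m2 : ℝ := Real.log (bigP D ^ (0.502 : ℝ) / y₂) with hm2
  have e0 : Real.log (yShift D y / bigP D ^ (0.5 : ℝ)) = l0 - Δ := by
    rw [hl0, Real.log_div hy₁0.ne' (Real.rpow_pos_of_pos hP0 _).ne',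
      Real.log_div hy₂0.ne' (Real.rpow_pos_of_pos hP0 _).ne', hlogy₁]; ring
  have e1 : Real.log (bigP D ^ (0.504 : ℝ) / yShift D y) = m1 + Δ := by
    rw [hm1, Real.log_div (Real.rpow_pos_of_pos hP0 _).ne' hy₁0.ne',
      Real.log_div (Real.rpow_pos_of_pos hP0 _).ne' hy₂0.ne', hlogy₁]; ring
  have e2 : Real.log (bigP D ^ (0.502 : ℝ) / yShift D y) = m2 + Δ := by
    rw [hm2, Real.log_div (Real.rpow_pos_of_pos hP0 _).ne' hy₁0.ne',
      Real.log_div (Real.rpow_pos_of_pos hP0 _).ne' hy₂0.ne', hlogy₁]; ring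
  have hm1b : |m1| ≤ 0.004 * ell D ^ 9 := by
    rw [hm1, Real.log_div (Real.rpow_pos_of_pos hP0 _).ne' hy₂0.ne', Real.log_rpow hP0, hlogP,
      hlogy₂, abs_le]; constructor <;> linarith
  have hm2b : |m2| ≤ 0.004 * ell D ^ 9 := by
    rw [hm2, Real.log_div (Real.rpow_pos_of_pos hP0 _).ne' hy₂0.ne', Real.log_rpow hP0, hlogP,
      hlogy₂, abs_le]; constructor <;> linarith
  -- the difference
  set βa : ℂ := betaJ c' D (j + 1) with hβa
  set βb : ℂ := betaJ c' D (j + 2) with hβb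
  have hβan : ‖βa‖ ≤ 6 * alpha D := norm_betaJ_le hc hα0.le hℓ0.le (j + 1)
  have hβbn : ‖βb‖ ≤ 6 * alpha D := norm_betaJ_le hc hα0.le hℓ0.le (j + 2)
  have hdiff : fraky1 c' D j (yShift D y) - fraky1 c' D j y₂ =
      (βa + βb) * ((-Δ : ℝ) : ℂ) +
        βa * βb / 2 * ((((2 * m1 + Δ) * Δ : ℝ) : ℂ) - 2 * ((((2 * m2 + Δ) * Δ : ℝ)) : ℂ)) := by
    rw [fraky1_apply, fraky1_apply, e0, e1, e2, ← hl0, ← hm1, ← hm2, ← hβa, ← hβb]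
    exact fraky1_shift_identity βa βb l0 m1 m2 Δ
  rw [hdiff]
  -- sizes of the two quadratic shifts
  have hq : ∀ m : ℝ, |m| ≤ 0.004 * ell D ^ 9 → |(2 * m + Δ) * Δ| ≤ 5 * ell D ^ 10 := by
    intro m hm
    rw [abs_mul, abs_of_nonneg hΔ0]
    have h1 : |2 * m + Δ| ≤ 0.008 * ell D ^ 9 + 520 * ell D := by
      calc |2 * m + Δ| ≤ |2 * m| + |Δ| := abs_add_le _ _
        _ = 2 * |m| + Δ := by rw [abs_mul, abs_two, abs_of_nonneg hΔ0]
        _ ≤ 2 * (0.004 * ell D ^ 9) + 520 * ell D := by gcongr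
        _ = _ := by ring
    have h8 : (390625 : ℝ) ≤ ell D ^ 8 := by
      calc (390625 : ℝ) = 5 ^ 8 := by norm_num
        _ ≤ ell D ^ 8 := pow_le_pow_left₀ (by norm_num) hL5 8
    calc |2 * m + Δ| * Δ ≤ (0.008 * ell D ^ 9 + 520 * ell D) * (520 * ell D) :=
          mul_le_mul h1 hΔle hΔ0 (by positivity)
      _ = 4.16 * ell D ^ 10 + 270400 * ell D ^ 2 := by ring
      _ ≤ 4.16 * ell D ^ 10 + 0.84 * ell D ^ 10 := by
          have : 270400 * ell D ^ 2 ≤ 0.84 * ell D ^ 10 := by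
            have h10 : ell D ^ 10 = ell D ^ 8 * ell D ^ 2 := by ring
            rw [h10]; nlinarith [pow_nonneg hℓ0.le 2]
          linarith
      _ = 5 * ell D ^ 10 := by ring
  have hq1 := hq m1 hm1b
  have hq2 := hq m2 hm2b
  calc ‖(βa + βb) * ((-Δ : ℝ) : ℂ) +
        βa * βb / 2 * ((((2 * m1 + Δ) * Δ : ℝ) : ℂ) - 2 * ((((2 * m2 + Δ) * Δ : ℝ)) : ℂ))‖
      ≤ ‖(βa + βb) * ((-Δ : ℝ) : ℂ)‖ +
        ‖βa * βb / 2 * ((((2 * m1 + Δ) * Δ : ℝ) : ℂ) - 2 * ((((2 * m2 + Δ) * Δ : ℝ)) : ℂ))‖ :=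
        norm_add_le _ _
    _ ≤ (6 * alpha D + 6 * alpha D) * (520 * ell D) +
        (6 * alpha D * (6 * alpha D) / 2) * (5 * ell D ^ 10 + 2 * (5 * ell D ^ 10)) := by
        gcongr
        · rw [norm_mul, Complex.norm_real, Real.norm_eq_abs, abs_neg, abs_of_nonneg hΔ0]
          gcongr
          exact (norm_add_le _ _).trans (add_le_add hβan hβbn)
        · rw [norm_mul, norm_div, norm_mul, Complex.norm_two]
          gcongr
          calc ‖((((2 * m1 + Δ) * Δ : ℝ) : ℂ) - 2 * ((((2 * m2 + Δ) * Δ : ℝ)) : ℂ))‖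
              ≤ ‖(((2 * m1 + Δ) * Δ : ℝ) : ℂ)‖ + ‖2 * ((((2 * m2 + Δ) * Δ : ℝ)) : ℂ)‖ :=
                norm_sub_le _ _
            _ = |(2 * m1 + Δ) * Δ| + 2 * |(2 * m2 + Δ) * Δ| := by
                rw [norm_mul, Complex.norm_two, Complex.norm_real, Complex.norm_real,
                  Real.norm_eq_abs, Real.norm_eq_abs]
            _ ≤ 5 * ell D ^ 10 + 2 * (5 * ell D ^ 10) := add_le_add hq1 (by gcongr)
    _ ≤ 7100 * alpha D * ell D :=
        yShift_arith hα0.le hℓ0.le (by rw [hαℓ9]; linarith [Real.pi_lt_d2])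

/-! ## §3. The `n`-sum on the windows: the three untwisted log-means, bounded crudely -/

/-- `∏_{q∣n}(1 − q⁻¹)⁻¹ = n/φ(n)` (`n ≠ 0`; cf. `PlateauMollifier.prod_primeFactors_one_sub_inv_inv`). [folklore] -/
private theorem prod_one_sub_inv_inv_eq' {n : ℕ} (hn : n ≠ 0) :
    ∏ q ∈ n.primeFactors, (1 - (q : ℝ)⁻¹)⁻¹ = (n : ℝ) / Nat.totient n := by
  rw [self_div_totient_eq_prod hn]
  refine Finset.prod_congr rfl fun q hq => ?_
  have h2 : (2 : ℝ) ≤ q := by exact_mod_cast (Nat.prime_of_mem_primeFactors hq).two_le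
  have hq0 : (q : ℝ) ≠ 0 := by linarith
  have hq1 : (q : ℝ) - 1 ≠ 0 := by linarith
  field_simp

/-- **An untwisted log-mean is at most `log X` times the absolute logarithmic mean**: for `X ≥ 1`,
`‖Σ_{n≤X} χ(n)ξ(n)n⁻¹log(X/n)‖ ≤ log X · Σ_{1≤n<⌈X⌉} |ξ(n)|/n` (`0 ≤ log(X/n) ≤ log X` for `n ≤ X`;
the term `n = X`, if present, carries `log 1 = 0`). [cite: Zhang2022LandauSiegel, §10 (10.11)] -/
theorem norm_logMean_le_log_mul (ξ : ℕ → ℂ) {X : ℝ} (hX : 1 ≤ X) :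
    ‖∑ n ∈ Finset.Ioc 0 ⌊X⌋₊, χ (n : ZMod D) * ξ n / (n : ℂ) * (Real.log (X / n) : ℂ)‖ ≤
      Real.log X * ∑ n ∈ Finset.Ico 1 ⌈X⌉₊, ‖ξ n‖ / n := by
  classical
  have hX0 : 0 < X := by linarith
  -- termwise: `‖term n‖ ≤ (‖ξ n‖/n)·log(X/n)`, and this is `≤ (‖ξ n‖/n)·log X` if `n < X`, `= 0` if `n = X`
  set g : ℕ → ℝ := fun n => if (n : ℝ) < X then ‖ξ n‖ / n * Real.log X else 0 with hg
  have hterm : ∀ n ∈ Finset.Ioc 0 ⌊X⌋₊,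
      ‖χ (n : ZMod D) * ξ n / (n : ℂ) * (Real.log (X / n) : ℂ)‖ ≤ g n := by
    intro n hn
    rw [Finset.mem_Ioc] at hn
    have hn0 : (0 : ℝ) < n := by exact_mod_cast hn.1
    have hn1 : (1 : ℝ) ≤ n := by exact_mod_cast hn.1
    have hnX : (n : ℝ) ≤ X := (Nat.cast_le.mpr hn.2).trans (Nat.floor_le hX0.le)
    have hlog0 : 0 ≤ Real.log (X / n) := Real.log_nonneg ((one_le_div hn0).mpr hnX)
    have hlogle : Real.log (X / n) ≤ Real.log X := by
      rw [Real.log_div hX0.ne' hn0.ne']; linarith [Real.log_nonneg hn1]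
    have hχ : ‖χ (n : ZMod D)‖ ≤ 1 := DirichletCharacter.norm_le_one χ _
    rw [norm_mul, norm_div, norm_mul, Complex.norm_natCast, Complex.norm_real,
      Real.norm_of_nonneg hlog0, hg]
    simp only
    split_ifs with hlt
    · calc ‖χ (n : ZMod D)‖ * ‖ξ n‖ / n * Real.log (X / n)
          ≤ 1 * ‖ξ n‖ / n * Real.log X := by gcongr
        _ = ‖ξ n‖ / n * Real.log X := by rw [one_mul]
    · have hnX' : (n : ℝ) = X := le_antisymm hnX (not_lt.mp hlt)
      rw [hnX', div_self hX0.ne', Real.log_one, mul_zero]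
  refine (norm_sum_le _ _).trans ((Finset.sum_le_sum hterm).trans ?_)
  have hg0 : ∀ n, 0 ≤ g n := by
    intro n; rw [hg]; simp only
    split_ifs
    · exact mul_nonneg (by positivity) (Real.log_nonneg hX)
    · exact le_rfl
  -- pass to the index set `Ico 1 ⌈X⌉` (contains every `n ∈ Ioc 0 ⌊X⌋` with `n < X`)
  have hsub : (Finset.Ioc 0 ⌊X⌋₊).filter (fun n : ℕ => (n : ℝ) < X) ⊆ Finset.Ico 1 ⌈X⌉₊ := by
    intro n hn
    rw [Finset.mem_filter, Finset.mem_Ioc] at hn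
    rw [Finset.mem_Ico]
    exact ⟨hn.1.1, Nat.lt_ceil.mpr hn.2⟩
  have hsplit : ∑ n ∈ Finset.Ioc 0 ⌊X⌋₊, g n =
      ∑ n ∈ (Finset.Ioc 0 ⌊X⌋₊).filter (fun n : ℕ => (n : ℝ) < X), g n := by
    rw [Finset.sum_filter]
    refine Finset.sum_congr rfl fun n _ => ?_
    rw [hg]; simp only
    split_ifs <;> simp
  rw [hsplit]
  calc ∑ n ∈ (Finset.Ioc 0 ⌊X⌋₊).filter (fun n : ℕ => (n : ℝ) < X), g n
      ≤ ∑ n ∈ Finset.Ico 1 ⌈X⌉₊, g n := Finset.sum_le_sum_of_subset_of_nonneg hsub fun n _ _ => hg0 n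
    _ ≤ ∑ n ∈ Finset.Ico 1 ⌈X⌉₊, ‖ξ n‖ / n * Real.log X := by
        refine Finset.sum_le_sum fun n _ => ?_
        rw [hg]; simp only
        split_ifs
        · exact le_rfl
        · exact mul_nonneg (by positivity) (Real.log_nonneg hX)
    _ = Real.log X * ∑ n ∈ Finset.Ico 1 ⌈X⌉₊, ‖ξ n‖ / n := by rw [← Finset.sum_mul, mul_comm]

/-- **Size of the log-mean main term**: for `0 ≤ L ≤ 𝓛⁹`, `‖β_k‖ ≤ 6α`, `α𝓛⁹ = π`:
`‖L′Π(1 + (β_a+β_b)L + ½β_aβ_bL²)‖ ≤ ‖L′‖‖Π‖(1 + 12π + 18π²)`. [cite: Zhang2022LandauSiegel, §10 Lemma 10.2] -/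
theorem norm_logMean_main_le (hc : |c'| * alpha D * ell D ≤ 1) (hα : 0 < alpha D)
    (hαL : alpha D * ell D ^ 9 = π) (hℓ : 0 ≤ ell D) (j : ℕ) (Lp Pi : ℂ) {L : ℝ} (hL0 : 0 ≤ L)
    (hL : L ≤ ell D ^ 9) :
    ‖Lp * Pi * (1 + (betaJ c' D (j + 1) + betaJ c' D (j + 2)) * (L : ℂ) +
        betaJ c' D (j + 1) * betaJ c' D (j + 2) * (L : ℂ) ^ 2 / 2)‖ ≤
      ‖Lp‖ * ‖Pi‖ * (1 + 12 * π + 18 * π ^ 2) := by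
  have hb1 := norm_betaJ_le hc hα.le hℓ (j + 1)
  have hb2 := norm_betaJ_le hc hα.le hℓ (j + 2)
  have hLn : ‖(L : ℂ)‖ = L := by rw [Complex.norm_real, Real.norm_of_nonneg hL0]
  have hαL' : alpha D * L ≤ π := by rw [← hαL]; exact mul_le_mul_of_nonneg_left hL hα.le
  have hin : ‖1 + (betaJ c' D (j + 1) + betaJ c' D (j + 2)) * (L : ℂ) +
      betaJ c' D (j + 1) * betaJ c' D (j + 2) * (L : ℂ) ^ 2 / 2‖ ≤ 1 + 12 * π + 18 * π ^ 2 := by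
    calc _ ≤ ‖(1 : ℂ)‖ + ‖(betaJ c' D (j + 1) + betaJ c' D (j + 2)) * (L : ℂ)‖ +
          ‖betaJ c' D (j + 1) * betaJ c' D (j + 2) * (L : ℂ) ^ 2 / 2‖ := norm_add₃_le
      _ ≤ 1 + (6 * alpha D + 6 * alpha D) * L + 6 * alpha D * (6 * alpha D) * L ^ 2 / 2 := by
          rw [norm_one, norm_mul, norm_div, norm_mul, norm_mul, norm_pow, hLn, Complex.norm_two]
          gcongr
          exact (norm_add_le _ _).trans (add_le_add hb1 hb2)
      _ = 1 + 12 * (alpha D * L) + 18 * (alpha D * L) ^ 2 := by ring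
      _ ≤ 1 + 12 * π + 18 * π ^ 2 := by
          have h0 : 0 ≤ alpha D * L := by positivity
          gcongr
  rw [norm_mul, norm_mul]
  exact mul_le_mul_of_nonneg_left hin (by positivity)

/-- **The shifted `𝔳₂ⱼ`-sum on a window, crude form.** At a modulus `D` with `P > 1`, `D ≥ 2`,
`d, r ≥ 1`, `y* ≥ 1`: if every untwisted log-mean `A(X)`, `X ≤ P`, is bounded by `B`, then
`‖frakv2S‖ ≤ (500/log P)·4B`. [cite: Zhang2022LandauSiegel, §10 (10.11), Remark p. 57] -/
theorem norm_frakv2S_le_of_logMean_le (j : ℕ) {d r : ℕ} (hd : 1 ≤ d) (hr : 1 ≤ r)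
    (hP : 1 < bigP D) (hD : 2 ≤ D) (hys1 : 1 ≤ yShift D ((d * r : ℕ) : ℝ)) {B : ℝ}
    (hB : ∀ X : ℝ, X ≤ bigP D →
      ‖∑ n ∈ Finset.Ioc 0 ⌊X⌋₊, χ (n : ZMod D) * xiZero c' D j n d r / (n : ℂ) *
          (Real.log (X / n) : ℂ)‖ ≤ B) [NeZero D] :
    ‖frakv2S c' χ j d r‖ ≤ 500 / Real.log (bigP D) * (4 * B) := by
  have hP0 : 0 < bigP D := by linarith
  rw [Lemma102.frakv2S_eq_logMeans χ c' j hd hr hP hD hys1]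
  set ys := yShift D ((d * r : ℕ) : ℝ)
  have hXle : ∀ a : ℝ, a ≤ 1 → bigP D ^ a / ys ≤ bigP D := fun a ha => by
    calc bigP D ^ a / ys ≤ bigP D ^ a := div_le_self (by positivity) hys1
      _ ≤ bigP D ^ (1 : ℝ) := Real.rpow_le_rpow_of_exponent_le hP.le ha
      _ = bigP D := Real.rpow_one _
  have h1 := hB _ (hXle 0.504 (by norm_num))
  have h2 := hB _ (hXle 0.502 (by norm_num))
  have h3 := hB _ (hXle 0.5 (by norm_num))
  have hΛ : 0 < Real.log (bigP D) := Real.log_pos hP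
  have hpre : ‖((500 / Real.log (bigP D) : ℝ) : ℂ)‖ = 500 / Real.log (bigP D) := by
    rw [Complex.norm_real, Real.norm_of_nonneg (by positivity)]
  rw [norm_mul, hpre]
  gcongr
  calc _ ≤ ‖(∑ n ∈ Finset.Ioc 0 ⌊bigP D ^ (0.504 : ℝ) / ys⌋₊,
            χ (n : ZMod D) * xiZero c' D j n d r / (n : ℂ) *
              (Real.log (bigP D ^ (0.504 : ℝ) / ys / n) : ℂ)) -
          2 * ∑ n ∈ Finset.Ioc 0 ⌊bigP D ^ (0.502 : ℝ) / ys⌋₊,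
            χ (n : ZMod D) * xiZero c' D j n d r / (n : ℂ) *
              (Real.log (bigP D ^ (0.502 : ℝ) / ys / n) : ℂ)‖ +
        ‖∑ n ∈ Finset.Ioc 0 ⌊bigP D ^ (0.5 : ℝ) / ys⌋₊,
            χ (n : ZMod D) * xiZero c' D j n d r / (n : ℂ) *
              (Real.log (bigP D ^ (0.5 : ℝ) / ys / n) : ℂ)‖ := norm_add_le _ _
    _ ≤ (B + 2 * B) + B := by
        refine add_le_add ((norm_sub_le _ _).trans (add_le_add h1 ?_)) h3
        rw [norm_mul, Complex.norm_two]; gcongr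
    _ = 4 * B := by ring

/-! ## §4. Weights over a logarithmic window -/

/-- For `1 ≤ A ≤ B` and any set `S` of integers in `[e^A, e^B]`:
`Σ_{n∈S}(n/φ(n))^k/n ≤ e^{2^{k+1}}(2 + (B − A))`. [cite: Zhang2022LandauSiegel, §10 p. 61] -/
theorem weight_sum_Icc_exp (k : ℕ) {A B : ℝ} (hA : 1 ≤ A) (hAB : A ≤ B) (S : Finset ℕ)
    (hS : ∀ n ∈ S, Real.exp A ≤ (n : ℝ) ∧ (n : ℝ) ≤ Real.exp B) :
    ∑ n ∈ S, ((n : ℝ) / Nat.totient n) ^ k / n ≤ Real.exp (2 ^ (k + 1)) * (2 + (B - A)) := by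
  set lo : ℝ := Real.exp A with hlo
  set hi : ℝ := Real.exp B with hhi
  have hlo0 : 0 < lo := Real.exp_pos _
  have hhi0 : 0 < hi := Real.exp_pos _
  have hlohi : lo ≤ hi := Real.exp_le_exp.mpr hAB
  have hlo2 : (2 : ℝ) ≤ lo := by
    calc (2 : ℝ) ≤ Real.exp 1 := by have := Real.exp_one_gt_d9; linarith
      _ ≤ Real.exp A := Real.exp_le_exp.mpr hA
  have hceil_lo : 2 ≤ ⌈lo⌉₊ := by
    have : (2 : ℝ) ≤ ⌈lo⌉₊ := hlo2.trans (Nat.le_ceil lo); exact_mod_cast this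
  set Y₀ : ℕ := ⌈lo⌉₊ - 1 with hY₀
  set X₀ : ℕ := ⌊hi⌋₊ with hX₀
  have hY₀1 : 1 ≤ Y₀ := by rw [hY₀]; omega
  have hY₀cast : (Y₀ : ℝ) = (⌈lo⌉₊ : ℝ) - 1 := by rw [hY₀, Nat.cast_sub (by omega), Nat.cast_one]
  have hY₀X₀ : Y₀ ≤ X₀ := by
    have h1 : (Y₀ : ℝ) < lo := by rw [hY₀cast]; linarith [Nat.ceil_lt_add_one hlo0.le]
    have h2 : (Y₀ : ℝ) < (X₀ : ℝ) + 1 := by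
      rw [hX₀]; exact lt_of_lt_of_le (h1.trans_le hlohi) (Nat.lt_floor_add_one hi).le
    have : Y₀ < X₀ + 1 := by exact_mod_cast h2
    omega
  have hS_sub : S ⊆ Finset.Ioc Y₀ X₀ := by
    intro n hn
    obtain ⟨hlon, hnhi⟩ := hS n hn
    rw [Finset.mem_Ioc, hY₀, hX₀]
    exact ⟨by have := Nat.ceil_le.mpr hlon; omega, Nat.le_floor hnhi⟩
  have h1 := sum_ratio_pow_div_le k hY₀1 hY₀X₀
  have hX₀log : Real.log X₀ ≤ B := by
    have hX₀pos : (0 : ℝ) < X₀ := by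
      have : (1 : ℝ) ≤ X₀ := by exact_mod_cast le_trans hY₀1 hY₀X₀
      linarith
    calc Real.log X₀ ≤ Real.log hi := Real.log_le_log hX₀pos (Nat.floor_le hhi0.le)
      _ = B := by rw [hhi]; exact Real.log_exp B
  have hY₀log : A - 1 ≤ Real.log Y₀ := by
    have h2 : lo / 2 ≤ Y₀ := by rw [hY₀cast]; linarith [Nat.le_ceil lo]
    have hl : Real.log (lo / 2) = A - Real.log 2 := by
      rw [Real.log_div hlo0.ne' (by norm_num), hlo, Real.log_exp]
    have hlog2 : Real.log 2 ≤ 1 := by have := Real.log_two_lt_d9; linarith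
    calc A - 1 ≤ Real.log (lo / 2) := by rw [hl]; linarith
      _ ≤ Real.log Y₀ := Real.log_le_log (by linarith) h2
  calc ∑ n ∈ S, ((n : ℝ) / Nat.totient n) ^ k / n
      ≤ ∑ n ∈ Finset.Ioc Y₀ X₀, ((n : ℝ) / Nat.totient n) ^ k / n :=
        Finset.sum_le_sum_of_subset_of_nonneg hS_sub fun n _ _ => by positivity
    _ ≤ Real.exp (2 ^ (k + 1)) * (1 + Real.log X₀ - Real.log Y₀) := h1
    _ ≤ Real.exp (2 ^ (k + 1)) * (2 + (B - A)) := by gcongr; linarith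

end W10Eval1214Tools

end Literature.NumberTheory.LFunctions.Zhang2022.Typed.Sec10C
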